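import Summits.QuantumFields.YangMills.Theorems.UnitScaleTiltHalvingHSiteTopRowsOfSocketsBase
import Summits.QuantumFields.YangMills.Theorems.UnitScaleTiltHalvingP1FlatCoreSupplierPreGaugeMember
import Summits.QuantumFields.YangMills.Theorems.UnitScaleTiltHalvingHSiteDatumOfSocketsTGammaTree
import Summits.QuantumFields.YangMills.Theorems.UnitScaleTiltHalvingP1FlatCoreCubeInclusion
import Summits.QuantumFields.YangMills.Theorems.UnitScaleTiltHalvingP1FlatCoreSupplierAssembly
import Summits.QuantumFields.YangMills.Theorems.UnitScaleTiltHalvingP1FlatCoreFrameLinLipschitz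
import Literature.MathematicalPhysics.QuantumFieldTheory.Balaban1983to89.B8SpecialUnitaryTrace
import HarnessLib

/-!
# `hP1room` PROGRAMME — THE BASE MEMBER's DATA, EDITION R (v3.2 of the H composers; ym-ust-20520-w5 g9's row (R3)): `baseData_of_socketsTR` = ✓`HalvingHSiteBaseDataOfSocketsT.
# baseData_of_socketsT` (p667136, v2 «T-EXPORT») WITH ONE MORE EXPORTED ROW — J3 (c′), the TREE-AXIALITY of the top average `Ū′^{(k)}` on □̃ from the corner `tLo a ρ′`
# (★w3-19200 g10's ✓`HalvingHSiteDatumOfSocketsTGammaTree.exists_preGauge_chart_su_tree` = my lineage's ✓`exists_preGauge_chart_su` + conj. 5 of ✓`exists_preGauge_flat` kept); everything else — hypotheses, the other 20 rows, the proof — VERBATIM (width seat `ym-ust-19200-w7` gen 7).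
# WHY: the datum-closed (1.42) collar residual `H42topCrossT` of the composers v3.2 carries (c′) as a guard on J3's gauge (it closes the open top transport from the knit root into
# loop holonomies for the (M2′) inhabitant — ym-ust-20520-w5 g9 01:35Z, ★w3-20520 g8 01:36Z); the k = 1 composer instantiates that guard from THIS row.  Below: v2's header, unchanged.
# `hP1room` PROGRAMME (LEAD-H BOARD v3 «H = hSupUρ3 ⟸ hMember», «w7-19200: FULL k = 1»): THE BASE MEMBER's DATA — J3's `SU(2)` gauge with its chart one-form, F3's
# tower at the composite gauge, and the base top step's rows, at ONE site of a member with `K − n = 1` — v2 «T-EXPORT»: J3's tower row (d) exported too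
# (the ∃-half of ✓`HalvingHSiteRowsOfSocketsBaseT.siteRows_of_sockets_baseT`; v1 = ✓`HalvingHSiteBaseDataOfSockets`)

Route `UnitScaleTilt`, crux K1 child «MinimiserStabilityRegPr» (stmt-QuantumFields-19200), registered stub `stub_halvingStep` (`BirthV10`).  Cell `ym3-torus` (HUMAN RULING
D-0037: YM₃ on T³ is ladder rung R3 — NOT d = 4, NOT a mass gap, NOT the Clay problem), width seat `ym-ust-19200-w7` gen 5.  `--supports stmt-QuantumFields-19200 --as helper`;
THEOREMS ONLY (0 `def`, 0 `sorry`); count-neutral; nothing here claims `hSupU`, `hMember`, the stub, the crux or the gap.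

WHAT.  ★★ `baseData_of_sockets` — under `hMember`'s antecedents at one site (`K − n = 1`; smallnesses `10⁷L³ε₀ ≤ 1`, `s ≤ 1∕6` at `s := (198 + 12(M′−1+4ρ′))ε₀`; the room;
`U ∈ 𝔘_k(ε₀) ∩ 𝔅_k(V)`; `t ∈ [0, M′−1]`, corner `a := Bᵏx₀ − t`), the base top step's windows, and the sockets `SLetτ` ([4] letters, ✓p654110's package at the member) and
`hTorus` ((D)(E)(τ) + six top windows, ∀-closed over the `SU(2)` gauge and F3's tower): `∃ gJ A κf λ′` with J3's rows for `U′ := pull (U^{gJ})♯ 0` ((1.34)-𝔄, axial,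
the chart `U′ = e^{iηA}` with `η‖A‖ ≤ 2s` on the sides touching `Ω 0` and on `□_k`, `A` Hermitian — ✓`exists_preGauge_chart_su` + lit ✓`collar_cube`∕✓`ends_of_sideTouches`),
F3's two tower rows (✓`exists_effGaugeFun` at the composite gauge, `u₁ := 1`), and the base top step's nine rows (✓p657394 `siteTopRows_of_sockets_base` at `k := K − n`,
`τ := tr`).  Inside: the corner ✓`corner_of_offset`, the room ✓`room_of_level_k` (`sitesPerDir k = 2L^{m+n}`), the no-wrap of □̃^{(k)}, `l1(tHi − tLo) = 3(M′ − 1 + 4ρ′)`.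
HONEST SCOPE.  By-name composition; `SLetτ`, `hTorus` and the windows stay DISPLAYED; nothing of Prop. 5, Theorem 4, [4], `core′` or the stub is proved here.

References: T. Bałaban, CMP **99** (1985) 75–102 [Balaban1985RegularSpaces] (Prop. 5 (1.106)–(1.109) p.94, Thm 4 p.88, (1.36) p.82, (1.131) p.99, p.98); CMP **99** (1985)
389–434 [Balaban1985BackgroundPropagators] (Thm 3.1 p.397, (3.25) p.394); CMP **102** (1985) 277–309 [Balaban1985Variational] ((2) p.278, (152) p.301);
CMP **98** (1985) 17–51 [Balaban1985Averaging] ((8) p.18, (208)–(214) p.50).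
-/

set_option autoImplicit false

noncomputable section

open scoped BigOperators Matrix.Norms.L2Operator
open NormedSpace
open Complex (I)

namespace Summit.QuantumFields.YangMills.Theorems.HalvingHSiteBaseDataOfSocketsTR

open Literature.MathematicalPhysics.QuantumFieldTheory.Balaban1983to89
open Literature.MathematicalPhysics.QuantumFieldTheory.Balaban1983to89.T3ContinuumYM3Torus
open Literature.MathematicalPhysics.QuantumFieldTheory.Balaban1983to89.T3PrintedRegularMinimiser (RegPr regFibrePr mem_regFibrePr_iff)
open T4Continuum
open MatrixLog (mlog)
open B5Eq118OneStroke (iterBlockOf)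
open B7Prop1Explicit (e expUnit l1)
open B7Prop1Explicit renaming Site → LSite
open B7Prop2Explicit (unitaryUnits C0 c2' avgIter)
open B7Prop3Flat (c3)
open B7Prop10General (C6 C4G)
open B7Prop9Flat (C5')
open B7Prop1Local (InBox loK bondHiK)
open B7Eq78Linearization (conjR zdBlocking QprimeIter Rbar_zero)
open B7Eq92Concrete (mgauge mgauge_apply)
open B8Ineq130 (tlo thi)
open B8Ineq132 (covDerivFwd InAk)
open B8Eq119TwistedAxial (Restr129 InAx bgT)
open B8Eq131Cubes (cube gs tLo tHi)
open B8Eq131CubesAdmissible (cubeFam cubeFam_false_of_le)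
open B8CubeMemberZd (cubeLamS cubeLamB)
open B8Eq184Proof (gaugeExp cfgExp)
open B8Eq182Proof (gAd)
open B8Eq188Proof (frakF3)
open B8Eq140Level (SideTouches)
open B8Eq146AExpansion (iEta)
open B8Eq138LandauZd (IsLandau138W covDivB covLap QT logCfg)
open B7Prop4GeneralLevels (logCovIter linCovIter)
open B8Eq155JBound (Jcur wsup)
open B8ScaledSupNorm (bondNorm msup)
open B8Eq1117Concrete (XSpace)
open B8Prop5ContractionKLevel (Bd2 Mc Kc)
open B8LambdaSpaceKLevel (wt)
open B8Eq178Averages (Qnl)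
open B8SpecialUnitaryTrace (trCLM trCLM_apply trCLM_mul_comm)
open B10Eq27TorusAxialLog (transl rel pull pull_apply unitsField toUField suIncl gaugeActT axialT unitsField_mem_unitaryUnits)
open B15Eq112TorusCover (lift cover)
open Node00 (coverAt)
open LatticeFieldCalculus (siteAvgIter)
open Summit.QuantumFields.YangMills.Theorems.Prop8ChartDoubleBar (dbarIterU vframeU)
open Summit.QuantumFields.YangMills.Theorems (FlatMinimizerH.le_T3)
open HalvingHSiteTopRowsOfSocketsBase (siteTopRows_of_sockets_base)
open HalvingHSiteDatumOfSocketsTGammaTree (exists_preGauge_chart_su_tree) open B8Lemma1NonAbelian (lowPart)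
open HalvingP1FlatCoreSupplierInduction (ends_of_sideTouches)
open P1FlatCoreCubeInclusion (corner_of_offset room_of_level_k)
open HalvingP1FlatCoreSupplierAssembly (hc₁_of_small)
open P1FlatCoreFrameLinLipschitz (exists_effGaugeFun)

variable (F : T3Family) {n K : ℕ}

set_option maxHeartbeats 400000 in
/-- ★★ **THE BASE MEMBER's DATA, T-EXPORT** (v2 of ✓`HalvingHSiteBaseDataOfSockets.baseData_of_sockets`): the same ∃-half, exporting IN ADDITION J3's tower row (d)
((1.66) at background `1` on the whole tower below □̃, for the same `gJ`) — the antecedent the v2 composer threads into Prop. 3's `H42`∕`H59` sockets.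
[cite: Balaban1985RegularSpaces, Prop. 5 (1.106)-(1.109) p.94, Thm 4 p.88, (1.36) p.82, (1.131) p.99, p.98; Balaban1985BackgroundPropagators, Thm 3.1 p.397, (3.25) p.394; Balaban1985Variational, (2) p.278, (152) p.301; Balaban1985Averaging, (8) p.18, (208)-(214) p.50] -/
theorem baseData_of_socketsTR (L : ℕ) (hF : F.L = L) (hnK : n < K) (hKn : K - n = 1)
    -- `hMember`'s antecedents read at one site: the member data, the pre-gauge's two smallnesses, the room, the field, the site; the window letter `t` and the corner `a`
    (ρ S M M' : ℕ) {ρ' : ℕ} (hρ'def : ρ' = ρ + M + L + S) {ε₀ : ℝ} (hε₀ : 0 < ε₀) (hε : 10 ^ 7 * (F.L : ℝ) ^ 3 * ε₀ ≤ 1)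
    {s : ℝ} (hsdef : s = (198 + 12 * (((M' : ℝ) - 1) + 4 * ρ')) * ε₀) (hs6 : s ≤ 1 / 6)
    (hroom : 2 * ρ + (M' + 1 + 2 * (M + L + S)) ≤ F.L ^ (F.m + n))
    (V : GaugeField (F.P n) 0 (Matrix.specialUnitaryGroup (Fin 2) ℂ)) (U : GaugeField (F.P K) 0 (Matrix.specialUnitaryGroup (Fin 2) ℂ))
    (hU : U ∈ regFibrePr F n K hnK.le ε₀ V) (x₀ : Site (F.P K) 0)
    {t : ℤ} (ht0 : 0 ≤ t) (ht : t ≤ (M' : ℤ) - 1)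
    {a : LSite (F.P K).d} (hadef : a = fun μ => ((iterBlockOf (K - n) x₀ μ).val : ℤ) - t)
    -- the base top step's constants and windows
    {α₄ cA cDA Cb Cl B₀'H B₂' BG BR : ℝ} (hα₄ : 0 < α₄) (hB₀'H : 0 < B₀'H) (hB₂' : 0 ≤ B₂') (hBG : 0 ≤ BG) (hBR : 0 ≤ BR)
    (hcAw : ((F.P K).L : ℝ) * (2 * s) ≤ cA) (hcDAw : 4 * ((F.P K).d : ℝ) * ((F.P K).L : ℝ) ^ 2 * s ≤ cDA) (hcA13 : cA ≤ 1 / 13)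
    (hCb : 0 ≤ Cb) (hCl : 0 ≤ Cl) (hCbρ : Cb ≤ α₄ / (2 * B₀'H)) (hClB : Cl * B₀'H ≤ 1 / 2)
    -- SOCKET: the [4] LETTERS at `(K − n, U₀ := 1)` as ONE package (✓p654110∕✓p657394's `SLetτ` at the member, `τ := tr`)
    (SLetτ : ∃ (g Δ : (LSite (F.P K).d → (Matrix (Fin 2) (Fin 2) ℂ)) →ₗ[ℂ] (LSite (F.P K).d → (Matrix (Fin 2) (Fin 2) ℂ))) (q : (LSite (F.P K).d → (Matrix (Fin 2) (Fin 2) ℂ)) →ₗ[ℂ] (ℕ → LSite (F.P K).d → (Matrix (Fin 2) (Fin 2) ℂ)))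
        (qs : (ℕ → LSite (F.P K).d → (Matrix (Fin 2) (Fin 2) ℂ)) →ₗ[ℂ] (LSite (F.P K).d → (Matrix (Fin 2) (Fin 2) ℂ))) (Aw c : (ℕ → LSite (F.P K).d → (Matrix (Fin 2) (Fin 2) ℂ)) →ₗ[ℂ] (ℕ → LSite (F.P K).d → (Matrix (Fin 2) (Fin 2) ℂ)))
        (H' : XSpace (F.P K).d (K - n) (Matrix (Fin 2) (Fin 2) ℂ) →ₗ[ℂ] (LSite (F.P K).d → (Matrix (Fin 2) (Fin 2) ℂ))),
      (∀ x, ∀ y ∈ (cubeFam false (F.P K).L a M' ρ' (K - n)) 0, (Δ (g x) + qs (Aw (q (g x)))) y = x y) ∧ (∀ f, q (g (g (qs (c (q f))))) = q f) ∧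
      (∀ (f : LSite (F.P K).d → (Matrix (Fin 2) (Fin 2) ℂ)), ∀ x ∈ (cubeFam false (F.P K).L a M' ρ' (K - n)) 0, Δ f x = covLap (((F.L : ℝ)⁻¹) ^ (K - n)) (1 : LSite (F.P K).d → Fin (F.P K).d → (Matrix (Fin 2) (Fin 2) ℂ)ˣ) (((cubeFam false (F.P K).L a M' ρ' (K - n)) 0).indicator f) x) ∧
      (∀ (μ : ℕ → LSite (F.P K).d → (Matrix (Fin 2) (Fin 2) ℂ)), ∀ x ∈ (cubeFam false (F.P K).L a M' ρ' (K - n)) 0, qs μ x = QT (F.P K).L (K - n) (cubeLamS (F.P K).L a M' ρ' (K - n) (K - n)) (1 : LSite (F.P K).d → Fin (F.P K).d → (Matrix (Fin 2) (Fin 2) ℂ)ˣ) μ x) ∧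
      (∀ (f : LSite (F.P K).d → (Matrix (Fin 2) (Fin 2) ℂ)) (j : ℕ), j ≤ K - n → ∀ y ∈ (cubeLamS (F.P K).L a M' ρ' (K - n) (K - n)) j, q f j y = QprimeIter (zdBlocking (F.P K).d (F.P K).L) (bgT (F.P K).L (1 : LSite (F.P K).d → Fin (F.P K).d → (Matrix (Fin 2) (Fin 2) ℂ)ˣ)) j f y) ∧
      (∀ (X : XSpace (F.P K).d (K - n) (Matrix (Fin 2) (Fin 2) ℂ)) (x : LSite (F.P K).d), ‖H' X x‖ ≤ B₀'H * ‖X‖) ∧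
      (∀ j, j ≤ K - n → ∀ (X : XSpace (F.P K).d (K - n) (Matrix (Fin 2) (Fin 2) ℂ)), ∀ p ∈ {b : LSite (F.P K).d × Fin (F.P K).d | SideTouches ((cubeFam false (F.P K).L a M' ρ' (K - n)) j) b.1 b.2},
        wt (F.P K).L (((F.L : ℝ)⁻¹) ^ (K - n)) j * ‖covDerivFwd (((F.L : ℝ)⁻¹) ^ (K - n)) (1 : LSite (F.P K).d → Fin (F.P K).d → (Matrix (Fin 2) (Fin 2) ℂ)ˣ) p.2 (H' X) p.1‖ ≤ B₀'H * ‖X‖) ∧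
      (∀ X : XSpace (F.P K).d (K - n) (Matrix (Fin 2) (Fin 2) ℂ), Bd2 (F.P K).L (((F.L : ℝ)⁻¹) ^ (K - n)) (K - n) (cubeFam false (F.P K).L a M' ρ' (K - n)) (covLap (((F.L : ℝ)⁻¹) ^ (K - n)) (1 : LSite (F.P K).d → Fin (F.P K).d → (Matrix (Fin 2) (Fin 2) ℂ)ˣ) (H' X)) (B₂' * ‖X‖)) ∧
      (∀ (X : XSpace (F.P K).d (K - n) (Matrix (Fin 2) (Fin 2) ℂ)) (x : LSite (F.P K).d), x ∉ (cubeFam false (F.P K).L a M' ρ' (K - n)) 0 → H' X x = 0) ∧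
      (∀ X Y : XSpace (F.P K).d (K - n) (Matrix (Fin 2) (Fin 2) ℂ), (∀ p, Y p = -star (X p)) → ∀ x, H' Y x = -star (H' X x)) ∧
      (∀ (Y : XSpace (F.P K).d (K - n) (Matrix (Fin 2) (Fin 2) ℂ)) (j : ℕ) (hj : j ≤ K - n) (y : LSite (F.P K).d), y ∈ (cubeLamS (F.P K).L a M' ρ' (K - n) (K - n)) j →
        QprimeIter (zdBlocking (F.P K).d (F.P K).L) (bgT (F.P K).L (1 : LSite (F.P K).d → Fin (F.P K).d → (Matrix (Fin 2) (Fin 2) ℂ)ˣ)) j (H' Y) y = Y (⟨j, Nat.lt_succ_of_le hj⟩, y)) ∧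
      (∀ (f : LSite (F.P K).d → (Matrix (Fin 2) (Fin 2) ℂ)) (r : ℝ), 0 ≤ r → Bd2 (F.P K).L (((F.L : ℝ)⁻¹) ^ (K - n)) (K - n) (cubeFam false (F.P K).L a M' ρ' (K - n)) f r →
        (∀ x, ‖g f x‖ ≤ BG * r) ∧ ∀ j, j ≤ K - n → ∀ p ∈ {b : LSite (F.P K).d × Fin (F.P K).d | SideTouches ((cubeFam false (F.P K).L a M' ρ' (K - n)) j) b.1 b.2},
          wt (F.P K).L (((F.L : ℝ)⁻¹) ^ (K - n)) j * ‖covDerivFwd (((F.L : ℝ)⁻¹) ^ (K - n)) (1 : LSite (F.P K).d → Fin (F.P K).d → (Matrix (Fin 2) (Fin 2) ℂ)ˣ) p.2 (g f) p.1‖ ≤ BG * r) ∧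
      (∀ (f : LSite (F.P K).d → (Matrix (Fin 2) (Fin 2) ℂ)) (x : LSite (F.P K).d), x ∉ (cubeFam false (F.P K).L a M' ρ' (K - n)) 0 → g f x = 0) ∧
      (∀ f : LSite (F.P K).d → (Matrix (Fin 2) (Fin 2) ℂ), (∀ j, j ≤ K - n → ∀ x ∈ (cubeFam false (F.P K).L a M' ρ' (K - n)) j, IsSelfAdjoint (f x)) → ∀ x, IsSelfAdjoint (g f x)) ∧
      (∀ (f : LSite (F.P K).d → (Matrix (Fin 2) (Fin 2) ℂ)) (r : ℝ), 0 ≤ r → Bd2 (F.P K).L (((F.L : ℝ)⁻¹) ^ (K - n)) (K - n) (cubeFam false (F.P K).L a M' ρ' (K - n)) f r → Bd2 (F.P K).L (((F.L : ℝ)⁻¹) ^ (K - n)) (K - n) (cubeFam false (F.P K).L a M' ρ' (K - n)) (f - g (qs (c (q (g f))))) (BR * r)) ∧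
      (∀ f : LSite (F.P K).d → (Matrix (Fin 2) (Fin 2) ℂ), (∀ j, j ≤ K - n → ∀ x ∈ (cubeFam false (F.P K).L a M' ρ' (K - n)) j, IsSelfAdjoint (f x)) → ∀ j, j ≤ K - n → ∀ x ∈ (cubeFam false (F.P K).L a M' ρ' (K - n)) j, IsSelfAdjoint ((f - g (qs (c (q (g f))))) x)) ∧
      (∀ X : XSpace (F.P K).d (K - n) (Matrix (Fin 2) (Fin 2) ℂ), (∀ p, trCLM (Fin 2) (X p) = 0) → ∀ x, trCLM (Fin 2) (H' X x) = 0) ∧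
      (∀ f : LSite (F.P K).d → (Matrix (Fin 2) (Fin 2) ℂ), (∀ j, j ≤ K - n → ∀ x ∈ (cubeFam false (F.P K).L a M' ρ' (K - n)) j, trCLM (Fin 2) (f x) = 0) → ∀ x, trCLM (Fin 2) (g f x) = 0) ∧
      (∀ f : LSite (F.P K).d → (Matrix (Fin 2) (Fin 2) ℂ), (∀ j, j ≤ K - n → ∀ x ∈ (cubeFam false (F.P K).L a M' ρ' (K - n)) j, trCLM (Fin 2) (f x) = 0) → ∀ j, j ≤ K - n → ∀ x ∈ (cubeFam false (F.P K).L a M' ρ' (K - n)) j, trCLM (Fin 2) ((f - g (qs (c (q (g f))))) x) = 0))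
    -- SOCKET: the TORUS package (blocks (D)(E)(τ) of the top step + its six windows at the member, `y₀ := Bᵏx₀`, `W₁ := (U♭)^{ĝJ}` at `u₁ := 1`), ∀-CLOSED over the
    -- member's `SU(2)` gauge (with J3's fine near-`1` on □̃ as antecedent) and over F3's tower `κf` (with its two defining rows); supplier = (K-site-Torus) at the top cube
    (hTorus : ∀ (gJ : GaugeTransf (F.P K) 0 (Matrix.specialUnitaryGroup (Fin 2) ℂ)),
      (∀ (x : LSite (F.P K).d) (ν : Fin (F.P K).d), tlo (F.P K).L (tLo a ρ') (K - n) ≤ x → x + e ν ≤ thi (F.P K).L (tHi a M' ρ') (K - n) →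
        ‖(((pull (unitsField (toUField (GaugeField.gaugeAct gJ U))) 0) x ν : (Matrix (Fin 2) (Fin 2) ℂ)ˣ) : (Matrix (Fin 2) (Fin 2) ℂ)) - 1‖ < s) →
      ∀ (κf : (Site (F.P K) 0 → (Matrix (Fin 2) (Fin 2) ℂ)) → (i : ℕ) → GaugeTransf (F.P K) i (Matrix (Fin 2) (Fin 2) ℂ)ˣ),
      (∀ (m : Site (F.P K) 0 → (Matrix (Fin 2) (Fin 2) ℂ)) (i : ℕ) (y : Site (F.P K) (i + 1)),
        κf m (i + 1) y = (vframeU (gaugeActT (κf m i) (dbarIterU i (gaugeActT (fun s => ((1 : LSite (F.P K).d → (Matrix (Fin 2) (Fin 2) ℂ)ˣ) (lift (F.P K) x₀ + rel x₀ s))⁻¹ * Unitary.toUnits (suIncl (gJ s)) : GaugeTransf (F.P K) 0 (Matrix (Fin 2) (Fin 2) ℂ)ˣ) (unitsField (toUField U))))) y)⁻¹ * κf m i (emb y) * vframeU (dbarIterU i (gaugeActT (fun s => ((1 : LSite (F.P K).d → (Matrix (Fin 2) (Fin 2) ℂ)ˣ) (lift (F.P K) x₀ + rel x₀ s))⁻¹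 * Unitary.toUnits (suIncl (gJ s)) : GaugeTransf (F.P K) 0 (Matrix (Fin 2) (Fin 2) ℂ)ˣ) (unitsField (toUField U)))) y) →
      (∀ (m : Site (F.P K) 0 → (Matrix (Fin 2) (Fin 2) ℂ)) (x : Site (F.P K) 0), ((κf m 0 x : (Matrix (Fin 2) (Fin 2) ℂ)ˣ) : (Matrix (Fin 2) (Fin 2) ℂ)) = exp (m x)) →
      ∃ th : XSpace (F.P K).d (K - n) (Matrix (Fin 2) (Fin 2) ℂ),
        B₀'H * ‖th‖ < α₄ / 4 ∧ (∀ p, star (th p) = -th p) ∧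
        (∀ yc ∈ (cubeLamS (F.P K).L a M' ρ' (K - n) (K - n)) (K - n), th (⟨K - n, Nat.lt_succ_self (K - n)⟩, yc) =
          mlog ((axialT (dbarIterU (K - n) (gaugeActT (fun s => ((1 : LSite (F.P K).d → (Matrix (Fin 2) (Fin 2) ℂ)ˣ) (lift (F.P K) x₀ + rel x₀ s))⁻¹ * Unitary.toUnits (suIncl (gJ s)) : GaugeTransf (F.P K) 0 (Matrix (Fin 2) (Fin 2) ℂ)ˣ) (unitsField (toUField U)))) (iterBlockOf (K - n) x₀) (coverAt (F.P K) (K - n) yc) : (Matrix (Fin 2) (Fin 2) ℂ)ˣ) : (Matrix (Fin 2) (Fin 2) ℂ))) ∧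
        (∀ (j : ℕ) (hj : j < K - n) (y : LSite (F.P K).d), y ∈ (cubeLamS (F.P K).L a M' ρ' (K - n) (K - n)) j → th (⟨j, Nat.lt_succ_of_lt hj⟩, y) = 0) ∧
        (∀ yc ∈ (cubeLamS (F.P K).L a M' ρ' (K - n) (K - n)) (K - n), ‖((axialT (dbarIterU (K - n) (gaugeActT (fun s => ((1 : LSite (F.P K).d → (Matrix (Fin 2) (Fin 2) ℂ)ˣ) (lift (F.P K) x₀ + rel x₀ s))⁻¹ * Unitary.toUnits (suIncl (gJ s)) : GaugeTransf (F.P K) 0 (Matrix (Fin 2) (Fin 2) ℂ)ˣ) (unitsField (toUField U)))) (iterBlockOf (K - n) x₀) (coverAt (F.P K) (K - n) yc) : (Matrix (Fin 2) (Fin 2) ℂ)ˣ) : (Matrix (Fin 2) (Fin 2) ℂ)) - 1‖ < 1) ∧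
        (∀ p, trCLM (Fin 2) (th p) = 0) ∧
        (α₄ / 4 + B₀'H * (Cb + ‖th‖) ≤ 1 / 24) ∧ (α₄ / 4 + B₀'H * (Cb + ‖th‖) ≤ 1 / 140) ∧
        (10 * (α₄ / 4 + B₀'H * (Cb + ‖th‖)) * BR ≤ 1 / 2) ∧ (B₀'H * (Cb + ‖th‖) ≤ 3 * α₄ / 4) ∧
        (BG * Mc (F.P K).d BR (α₄ / 4 + B₀'H * (Cb + ‖th‖)) cA (B₂' * (Cb + ‖th‖)) cDA ≤ α₄ / 4) ∧
        (BG * Kc (F.P K).d BR (α₄ / 4 + B₀'H * (Cb + ‖th‖)) cA (B₂' * (Cb + ‖th‖)) cDA (B₂' * (2 * Cl)) (1 + B₀'H * (2 * Cl)) (1 + B₀'H * (2 * Cl)) ≤ 1 / 2) ∧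
        (∀ yc ∈ (cubeLamS (F.P K).L a M' ρ' (K - n) (K - n)) (K - n), ∀ l₀ : Site (F.P K) 0 → (Matrix (Fin 2) (Fin 2) ℂ),
          (∀ x : LSite (F.P K).d, InBox (tlo (F.P K).L yc (K - n)) (thi (F.P K).L yc (K - n)) x → ‖l₀ (cover (F.P K) x)‖ ≤ α₄) →
          (∀ (x : LSite (F.P K).d) (κ : Fin (F.P K).d), InBox (tlo (F.P K).L yc (K - n)) (thi (F.P K).L yc (K - n)) x →
            InBox (tlo (F.P K).L yc (K - n)) (thi (F.P K).L yc (K - n)) (x + e κ) → ‖l₀ (cover (F.P K) (x + e κ)) - l₀ (cover (F.P K) x)‖ ≤ α₄ * (((F.P K).L : ℝ) ^ (K - n))⁻¹) →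
          exp (mlog ((κf l₀ (K - n) (coverAt (F.P K) (K - n) yc) : (Matrix (Fin 2) (Fin 2) ℂ)ˣ) : (Matrix (Fin 2) (Fin 2) ℂ))) = ((κf l₀ (K - n) (coverAt (F.P K) (K - n) yc) : (Matrix (Fin 2) (Fin 2) ℂ)ˣ) : (Matrix (Fin 2) (Fin 2) ℂ)) ∧
            ‖mlog ((κf l₀ (K - n) (coverAt (F.P K) (K - n) yc) : (Matrix (Fin 2) (Fin 2) ℂ)ˣ) : (Matrix (Fin 2) (Fin 2) ℂ)) - siteAvgIter (K - n) l₀ (coverAt (F.P K) (K - n) yc)‖ ≤ Cb) ∧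
        (∀ yc ∈ (cubeLamS (F.P K).L a M' ρ' (K - n) (K - n)) (K - n), ∀ (l₁ l₂ : Site (F.P K) 0 → (Matrix (Fin 2) (Fin 2) ℂ)) (r : ℝ), 0 ≤ r →
          (∀ x : LSite (F.P K).d, InBox (tlo (F.P K).L yc (K - n)) (thi (F.P K).L yc (K - n)) x → ‖l₁ (cover (F.P K) x)‖ ≤ α₄) →
          (∀ (x : LSite (F.P K).d) (κ : Fin (F.P K).d), InBox (tlo (F.P K).L yc (K - n)) (thi (F.P K).L yc (K - n)) x →
            InBox (tlo (F.P K).L yc (K - n)) (thi (F.P K).L yc (K - n)) (x + e κ) → ‖l₁ (cover (F.P K) (x + e κ)) - l₁ (cover (F.P K) x)‖ ≤ α₄ * (((F.P K).L : ℝ) ^ (K - n))⁻¹) →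
          (∀ x : LSite (F.P K).d, InBox (tlo (F.P K).L yc (K - n)) (thi (F.P K).L yc (K - n)) x → ‖l₂ (cover (F.P K) x)‖ ≤ α₄) →
          (∀ (x : LSite (F.P K).d) (κ : Fin (F.P K).d), InBox (tlo (F.P K).L yc (K - n)) (thi (F.P K).L yc (K - n)) x →
            InBox (tlo (F.P K).L yc (K - n)) (thi (F.P K).L yc (K - n)) (x + e κ) → ‖l₂ (cover (F.P K) (x + e κ)) - l₂ (cover (F.P K) x)‖ ≤ α₄ * (((F.P K).L : ℝ) ^ (K - n))⁻¹) →
          (∀ x : LSite (F.P K).d, InBox (tlo (F.P K).L yc (K - n)) (thi (F.P K).L yc (K - n)) x → ‖l₁ (cover (F.P K) x) - l₂ (cover (F.P K) x)‖ ≤ r) →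
          (∀ (x : LSite (F.P K).d) (κ : Fin (F.P K).d), InBox (tlo (F.P K).L yc (K - n)) (thi (F.P K).L yc (K - n)) x →
            InBox (tlo (F.P K).L yc (K - n)) (thi (F.P K).L yc (K - n)) (x + e κ) →
            ‖(l₁ (cover (F.P K) (x + e κ)) - l₂ (cover (F.P K) (x + e κ))) - (l₁ (cover (F.P K) x) - l₂ (cover (F.P K) x))‖ ≤ r * (((F.P K).L : ℝ) ^ (K - n))⁻¹) →
          ‖(mlog ((κf l₁ (K - n) (coverAt (F.P K) (K - n) yc) : (Matrix (Fin 2) (Fin 2) ℂ)ˣ) : (Matrix (Fin 2) (Fin 2) ℂ)) - siteAvgIter (K - n) l₁ (coverAt (F.P K) (K - n) yc)) -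
              (mlog ((κf l₂ (K - n) (coverAt (F.P K) (K - n) yc) : (Matrix (Fin 2) (Fin 2) ℂ)ˣ) : (Matrix (Fin 2) (Fin 2) ℂ)) - siteAvgIter (K - n) l₂ (coverAt (F.P K) (K - n) yc))‖ ≤ Cl * r) ∧
        (∀ yc ∈ (cubeLamS (F.P K).L a M' ρ' (K - n) (K - n)) (K - n), ∀ l₀ : Site (F.P K) 0 → (Matrix (Fin 2) (Fin 2) ℂ),
          (∀ x : LSite (F.P K).d, InBox (tlo (F.P K).L yc (K - n)) (thi (F.P K).L yc (K - n)) x → ‖l₀ (cover (F.P K) x)‖ ≤ α₄) →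
          (∀ (x : LSite (F.P K).d) (κ : Fin (F.P K).d), InBox (tlo (F.P K).L yc (K - n)) (thi (F.P K).L yc (K - n)) x →
            InBox (tlo (F.P K).L yc (K - n)) (thi (F.P K).L yc (K - n)) (x + e κ) → ‖l₀ (cover (F.P K) (x + e κ)) - l₀ (cover (F.P K) x)‖ ≤ α₄ * (((F.P K).L : ℝ) ^ (K - n))⁻¹) →
          mlog ((κf (fun s => -star (l₀ s)) (K - n) (coverAt (F.P K) (K - n) yc) : (Matrix (Fin 2) (Fin 2) ℂ)ˣ) : (Matrix (Fin 2) (Fin 2) ℂ)) - siteAvgIter (K - n) (fun s => -star (l₀ s)) (coverAt (F.P K) (K - n) yc) =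
            -star (mlog ((κf l₀ (K - n) (coverAt (F.P K) (K - n) yc) : (Matrix (Fin 2) (Fin 2) ℂ)ˣ) : (Matrix (Fin 2) (Fin 2) ℂ)) - siteAvgIter (K - n) l₀ (coverAt (F.P K) (K - n) yc))) ∧
        (∀ yc ∈ (cubeLamS (F.P K).L a M' ρ' (K - n) (K - n)) (K - n), ∀ l₀ : Site (F.P K) 0 → (Matrix (Fin 2) (Fin 2) ℂ), (∀ s, trCLM (Fin 2) (l₀ s) = 0) →
          (∀ x : LSite (F.P K).d, InBox (tlo (F.P K).L yc (K - n)) (thi (F.P K).L yc (K - n)) x → ‖l₀ (cover (F.P K) x)‖ ≤ α₄) →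
          (∀ (x : LSite (F.P K).d) (κ : Fin (F.P K).d), InBox (tlo (F.P K).L yc (K - n)) (thi (F.P K).L yc (K - n)) x →
            InBox (tlo (F.P K).L yc (K - n)) (thi (F.P K).L yc (K - n)) (x + e κ) → ‖l₀ (cover (F.P K) (x + e κ)) - l₀ (cover (F.P K) x)‖ ≤ α₄ * (((F.P K).L : ℝ) ^ (K - n))⁻¹) →
          trCLM (Fin 2) (mlog ((κf l₀ (K - n) (coverAt (F.P K) (K - n) yc) : (Matrix (Fin 2) (Fin 2) ℂ)ˣ) : (Matrix (Fin 2) (Fin 2) ℂ)) - siteAvgIter (K - n) l₀ (coverAt (F.P K) (K - n) yc)) = 0)) :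
    ∃ (gJ : GaugeTransf (F.P K) 0 (Matrix.specialUnitaryGroup (Fin 2) ℂ)) (A : LSite (F.P K).d → Fin (F.P K).d → Matrix (Fin 2) (Fin 2) ℂ)
      (κf : (Site (F.P K) 0 → Matrix (Fin 2) (Fin 2) ℂ) → (i : ℕ) → GaugeTransf (F.P K) i (Matrix (Fin 2) (Fin 2) ℂ)ˣ)
      (lam : LSite (F.P K).d → Matrix (Fin 2) (Fin 2) ℂ),
      -- J3's rows for `U′ := pull (U^{gJ})♯ 0`: (1.34)-𝔄, axial, the chart on the sides touching `Ω 0` and on `□_k`, `A` Hermitian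
      InAk (F.P K).L (K - n) (((F.L : ℝ)⁻¹) ^ (K - n)) ε₀ (fun _ => (Set.univ : Set (LSite (F.P K).d))) (pull (unitsField (toUField (GaugeField.gaugeAct gJ U))) 0) ∧
      (∀ m', m' ≤ K - n → ∀ Λ : ℕ → Set (LSite (F.P K).d), InAx (F.P K).L m' Λ (1 : LSite (F.P K).d → Fin (F.P K).d → (Matrix (Fin 2) (Fin 2) ℂ)ˣ) (pull (unitsField (toUField (GaugeField.gaugeAct gJ U))) 0)) ∧
      -- EDITION R (v3.2, row (R3)): J3 (c′) — the top average `Ū′^{(k)}` is TREE-AXIAL on □̃ from the corner `tLo a ρ′` (✓`exists_preGauge_chart_su_tree`)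
      (∀ (x : LSite (F.P K).d) (ν : Fin (F.P K).d), tLo a ρ' ≤ x → x + e ν ≤ tHi a M' ρ' → lowPart ν (x - tLo a ρ') = 0 →
        avgIter (F.P K).L (pull (unitsField (toUField (GaugeField.gaugeAct gJ U))) 0) (K - n) x ν = 1) ∧
      (∀ m', m' ≤ K - n → ∀ (x : LSite (F.P K).d) (ν : Fin (F.P K).d), tlo (F.P K).L (tLo a ρ') m' ≤ x → x + e ν ≤ thi (F.P K).L (tHi a M' ρ') m' →
        ‖((avgIter (F.P K).L (pull (unitsField (toUField (GaugeField.gaugeAct gJ U))) 0) (K - n - m') x ν : (Matrix (Fin 2) (Fin 2) ℂ)ˣ) :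
            Matrix (Fin 2) (Fin 2) ℂ) - 1‖ < s) ∧
      (∀ (y : LSite (F.P K).d) (τ : Fin (F.P K).d), SideTouches (cubeFam false (F.P K).L a M' ρ' (K - n) 0) y τ →
        (pull (unitsField (toUField (GaugeField.gaugeAct gJ U))) 0) y τ = cfgExp (((F.L : ℝ)⁻¹) ^ (K - n)) A y τ ∧ (((F.L : ℝ)⁻¹) ^ (K - n)) * ‖A y τ‖ ≤ 2 * s) ∧
      (∀ z ∈ cube (F.P K).L a M' ρ' (K - n) (K - n), ∀ ν : Fin (F.P K).d,
        (pull (unitsField (toUField (GaugeField.gaugeAct gJ U))) 0) z ν = cfgExp (((F.L : ℝ)⁻¹) ^ (K - n)) A z ν ∧ (((F.L : ℝ)⁻¹) ^ (K - n)) * ‖A z ν‖ ≤ 2 * s) ∧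
      (∀ (x : LSite (F.P K).d) (μ : Fin (F.P K).d), IsSelfAdjoint (A x μ)) ∧
      -- F3's tower of the charted iterate at the composite gauge (`u₁ := 1`)
      (∀ (m : Site (F.P K) 0 → Matrix (Fin 2) (Fin 2) ℂ) (i : ℕ) (y : Site (F.P K) (i + 1)),
        κf m (i + 1) y = (vframeU (gaugeActT (κf m i) (dbarIterU i (gaugeActT (fun s => ((1 : LSite (F.P K).d → (Matrix (Fin 2) (Fin 2) ℂ)ˣ) (lift (F.P K) x₀ + rel x₀ s))⁻¹ * Unitary.toUnits (suIncl (gJ s)) : GaugeTransf (F.P K) 0 (Matrix (Fin 2) (Fin 2) ℂ)ˣ) (unitsField (toUField U))))) y)⁻¹ * κf m i (emb y) * vframeU (dbarIterU i (gaugeActT (fun s => ((1 : LSite (F.P K).d → (Matrix (Fin 2) (Fin 2) ℂ)ˣ) (lift (F.P K) x₀ + rel x₀ s))⁻¹ * Unitary.toUnits (suIncl (gJ s)) : GaugeTransf (F.P K) 0 (Matrix (Fin 2) (Fin 2) ℂ)ˣ) (unitsField (toUField U)))) y) ∧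
      (∀ (m : Site (F.P K) 0 → Matrix (Fin 2) (Fin 2) ℂ) (x : Site (F.P K) 0), ((κf m 0 x : (Matrix (Fin 2) (Fin 2) ℂ)ˣ) : Matrix (Fin 2) (Fin 2) ℂ) = exp (m x)) ∧
      -- the base top step's rows (✓p657394's conjuncts at the member)
      (∀ x, IsSelfAdjoint (lam x)) ∧ (∀ x, x ∉ (cubeFam false (F.P K).L a M' ρ' (K - n) 0) → lam x = 0) ∧ (∀ x, (lam x).trace = 0) ∧
      (∀ j, j ≤ K - n → ∀ b ∈ {b : LSite (F.P K).d × Fin (F.P K).d | SideTouches (cubeFam false (F.P K).L a M' ρ' (K - n) j) b.1 b.2},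
        ‖lam b.1‖ ≤ α₄ ∧ wt (F.P K).L (((F.L : ℝ)⁻¹) ^ (K - n)) j * ‖covDerivFwd (((F.L : ℝ)⁻¹) ^ (K - n)) (1 : LSite (F.P K).d → Fin (F.P K).d → (Matrix (Fin 2) (Fin 2) ℂ)ˣ) b.2 lam b.1‖ ≤ α₄) ∧
      (∃ μ : ℕ → LSite (F.P K).d → Matrix (Fin 2) (Fin 2) ℂ, ∀ x ∈ (cubeFam false (F.P K).L a M' ρ' (K - n) 0),
        covLap (((F.L : ℝ)⁻¹) ^ (K - n)) (1 : LSite (F.P K).d → Fin (F.P K).d → (Matrix (Fin 2) (Fin 2) ℂ)ˣ) ((cubeFam false (F.P K).L a M' ρ' (K - n) 0).indicator fun y =>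
          covDivB (((F.L : ℝ)⁻¹) ^ (K - n)) (1 : LSite (F.P K).d → Fin (F.P K).d → (Matrix (Fin 2) (Fin 2) ℂ)ˣ) A y +
          covLap (((F.L : ℝ)⁻¹) ^ (K - n)) (1 : LSite (F.P K).d → Fin (F.P K).d → (Matrix (Fin 2) (Fin 2) ℂ)ˣ) lam y +
          ((conjR (gaugeExp lam y)⁻¹ (covDivB (((F.L : ℝ)⁻¹) ^ (K - n)) (1 : LSite (F.P K).d → Fin (F.P K).d → (Matrix (Fin 2) (Fin 2) ℂ)ˣ) A y) -
              covDivB (((F.L : ℝ)⁻¹) ^ (K - n)) (1 : LSite (F.P K).d → Fin (F.P K).d → (Matrix (Fin 2) (Fin 2) ℂ)ˣ) A y) +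
            (gAd (covLap (((F.L : ℝ)⁻¹) ^ (K - n)) (1 : LSite (F.P K).d → Fin (F.P K).d → (Matrix (Fin 2) (Fin 2) ℂ)ˣ) lam y) (lam y) -
              covLap (((F.L : ℝ)⁻¹) ^ (K - n)) (1 : LSite (F.P K).d → Fin (F.P K).d → (Matrix (Fin 2) (Fin 2) ℂ)ˣ) lam y) +
            ∑ μ, frakF3 (((F.L : ℝ)⁻¹) ^ (K - n)) (1 : LSite (F.P K).d → Fin (F.P K).d → (Matrix (Fin 2) (Fin 2) ℂ)ˣ) lam A y μ)) x =
        QT (F.P K).L (K - n) (cubeLamS (F.P K).L a M' ρ' (K - n) (K - n)) (1 : LSite (F.P K).d → Fin (F.P K).d → (Matrix (Fin 2) (Fin 2) ℂ)ˣ) μ x) ∧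
      (∀ j, j < K - n → ∀ y ∈ cubeLamS (F.P K).L a M' ρ' (K - n) (K - n) j,
        Qnl (F.P K).L (1 : LSite (F.P K).d → Fin (F.P K).d → (Matrix (Fin 2) (Fin 2) ℂ)ˣ) (fun x => expUnit (((-I) • lam) x)) (1 : LSite (F.P K).d → (Matrix (Fin 2) (Fin 2) ℂ)ˣ)⁻¹ j y = 0) ∧
      (∀ yc ∈ cubeLamS (F.P K).L a M' ρ' (K - n) (K - n) (K - n),
        κf (((-I) • lam) ∘ fun s : Site (F.P K) 0 => lift (F.P K) x₀ + rel x₀ s) (K - n) (coverAt (F.P K) (K - n) yc) =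
          axialT (dbarIterU (K - n) (gaugeActT (fun s => ((1 : LSite (F.P K).d → (Matrix (Fin 2) (Fin 2) ℂ)ˣ) (lift (F.P K) x₀ + rel x₀ s))⁻¹ * Unitary.toUnits (suIncl (gJ s)) : GaugeTransf (F.P K) 0 (Matrix (Fin 2) (Fin 2) ℂ)ˣ) (unitsField (toUField U)))) (iterBlockOf (K - n) x₀) (coverAt (F.P K) (K - n) yc)) ∧
      (∀ x ∈ (cubeFam false (F.P K).L a M' ρ' (K - n) 0), ∀ μ : Fin (F.P K).d,
        wt (F.P K).L (((F.L : ℝ)⁻¹) ^ (K - n)) 0 * ‖A x μ‖ ≤ cA ∧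
          wt (F.P K).L (((F.L : ℝ)⁻¹) ^ (K - n)) 0 * ‖conjR ((1 : LSite (F.P K).d → Fin (F.P K).d → (Matrix (Fin 2) (Fin 2) ℂ)ˣ) (x - e μ) μ)⁻¹ (A (x - e μ) μ)‖ ≤ cA) := by
  classical
  letI : CStarAlgebra (Matrix (Fin 2) (Fin 2) ℂ) := {}
  subst hadef hρ'def
  -- letters of the member
  have hd3 : (F.P K).d = 3 := T3Family.P_d F K
  have hd2 : 2 ≤ (F.P K).d := by rw [hd3]; norm_num
  have hL2 : 2 ≤ (F.P K).L := (F.P K).hL.2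
  have hLF : (F.P K).L = F.L := rfl
  have hL3 : 3 ≤ F.L := by obtain ⟨⟨r, hr⟩, h1⟩ := F.hL; omega
  have hL0 : (0 : ℝ) < F.L := by exact_mod_cast (F.P K).L_pos
  have hkP : K - n ≤ (F.P K).m + (F.P K).K := FlatMinimizerH.le_T3 F n K
  have hη : 0 < ((F.L : ℝ)⁻¹) ^ (K - n) := by positivity
  have hM'1 : (1 : ℤ) ≤ M' := by linarith
  have hρL : (F.P K).L ≤ (ρ + M + L + S) := by rw [hLF, ← hF]; omega
  have hρ1 : 1 ≤ (ρ + M + L + S) := le_trans (by omega) hρL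
  have hs0 : 0 ≤ s := by
    rw [hsdef]
    have : (0 : ℝ) ≤ ((M' : ℝ) - 1) := by
      have : (1 : ℝ) ≤ M' := by exact_mod_cast hM'1
      linarith
    positivity
  have hUreg : RegPr F n K ε₀ U := ((mem_regFibrePr_iff F).1 hU).2
  -- the window letters: the corner, the room, the no-wrap, J3's descent window
  have ha := corner_of_offset x₀ (K - n) (M' := M') ht0 ht
  have hsites : (F.P K).sitesPerDir (K - n) = 2 * F.L ^ (F.m + n) := by
    show 2 * F.L ^ (F.m + K - (K - n)) = _
    congr 2; omega
  have hroomW : 2 * ((F.P K).L ^ (K - n) * (M' + 1) + (ρ + M + L + S) * gs (F.P K).L (K - n)) ≤ (F.P K).sitesPerDir 0 := by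
    refine room_of_level_k (P := F.P K) hkP ?_
    rw [hsites, ← hF]; omega
  have hwrap : ∀ i, tHi (fun μ => ((iterBlockOf (K - n) x₀ μ).val : ℤ) - t) M' (ρ + M + L + S) i - tLo (fun μ => ((iterBlockOf (K - n) x₀ μ).val : ℤ) - t) (ρ + M + L + S) i <
      ((F.P K).sitesPerDir (K - n) : ℤ) := by
    intro i
    simp only [tHi, tLo, hsites]
    have h : (M' : ℤ) - 1 + 4 * (ρ + M + L + S) < 2 * (F.L : ℤ) ^ (F.m + n) := by
      have h1 : 2 * ρ + (M' + 1 + 2 * (M + L + S)) ≤ F.L ^ (F.m + n) := hroom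
      have h2 : ((2 * ρ + (M' + 1 + 2 * (M + L + S)) : ℕ) : ℤ) ≤ ((F.L ^ (F.m + n) : ℕ) : ℤ) := by exact_mod_cast h1
      push_cast at h2
      linarith
    push_cast; linarith
  have hl1 : (l1 (tHi (fun μ => ((iterBlockOf (K - n) x₀ μ).val : ℤ) - t) M' (ρ + M + L + S) - tLo (fun μ => ((iterBlockOf (K - n) x₀ μ).val : ℤ) - t) (ρ + M + L + S)) : ℝ) =
      3 * (((M' : ℝ) - 1) + 4 * (ρ + M + L + S)) := by
    unfold l1
    have hterm : ∀ κ : Fin (F.P K).d,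
        (((tHi (fun μ => ((iterBlockOf (K - n) x₀ μ).val : ℤ) - t) M' (ρ + M + L + S) - tLo (fun μ => ((iterBlockOf (K - n) x₀ μ).val : ℤ) - t) (ρ + M + L + S)) κ).natAbs : ℝ) =
          ((M' : ℝ) - 1) + 4 * (ρ + M + L + S) := by
      intro κ
      have hv : (tHi (fun μ => ((iterBlockOf (K - n) x₀ μ).val : ℤ) - t) M' (ρ + M + L + S) - tLo (fun μ => ((iterBlockOf (K - n) x₀ μ).val : ℤ) - t) (ρ + M + L + S)) κ =
          (M' : ℤ) - 1 + 4 * (ρ + M + L + S) := by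
        simp only [Pi.sub_apply, tHi, tLo]; push_cast; ring
      have hnn : (0 : ℤ) ≤ (M' : ℤ) - 1 + 4 * (ρ + M + L + S) := by positivity
      have hnnR : (0 : ℝ) ≤ (((M' : ℤ) - 1 + 4 * (ρ + M + L + S) : ℤ) : ℝ) := by exact_mod_cast hnn
      rw [hv, Nat.cast_natAbs, Int.cast_abs, abs_of_nonneg hnnR]
      push_cast; ring
    rw [Nat.cast_sum, Finset.sum_congr rfl fun κ _ => hterm κ, Finset.sum_const, Finset.card_univ, Fintype.card_fin, hd3, nsmul_eq_mul]
    push_cast; ring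
  have hsmallJ : 11 * ((F.P K).d : ℝ) ^ 2 * (2 * ε₀) +
      l1 (tHi (fun μ => ((iterBlockOf (K - n) x₀ μ).val : ℤ) - t) M' (ρ + M + L + S) - tLo (fun μ => ((iterBlockOf (K - n) x₀ μ).val : ℤ) - t) (ρ + M + L + S)) * (2 * (2 * ε₀)) ≤ 1 / 6 := by
    rw [hl1, hd3]
    have e : (11 : ℝ) * ((3 : ℕ) : ℝ) ^ 2 * (2 * ε₀) + 3 * (((M' : ℝ) - 1) + 4 * (ρ + M + L + S)) * (2 * (2 * ε₀)) = s := by rw [hsdef]; push_cast; ring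
    rw [e]; exact hs6
  have hsJ : 11 * ((F.P K).d : ℝ) ^ 2 * (2 * ε₀) +
      l1 (tHi (fun μ => ((iterBlockOf (K - n) x₀ μ).val : ℤ) - t) M' (ρ + M + L + S) - tLo (fun μ => ((iterBlockOf (K - n) x₀ μ).val : ℤ) - t) (ρ + M + L + S)) * (2 * (2 * ε₀)) = s := by
    rw [hl1, hd3, hsdef]; push_cast; ring
  -- J3 at the member with the SU(2) gauge explicit, edition R with the tree-axiality row (✓`exists_preGauge_chart_su_tree`, ★w3-19200 g10)
  obtain ⟨gJ, A, hbridge, hInAk, hInAx, htree, htower, hAsa, hAtr, hAhalf, hterr⟩ :=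
    exists_preGauge_chart_su_tree F hnK hε₀ hε hUreg (fun μ => ((iterBlockOf (K - n) x₀ μ).val : ℤ) - t) M' (ρ + M + L + S) hwrap hsmallJ
  rw [hsJ] at hterr htower
  have hAτ : ∀ (x : LSite (F.P K).d) (μ : Fin (F.P K).d), trCLM (Fin 2) (A x μ) = 0 := fun x μ => by rw [trCLM_apply]; exact hAtr x μ
  have hU' : ∀ (x : LSite (F.P K).d) (κ : Fin (F.P K).d), pull (unitsField (toUField (GaugeField.gaugeAct gJ U))) 0 x κ ∈ unitaryUnits (Matrix (Fin 2) (Fin 2) ℂ) :=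
    fun x κ => by rw [pull_apply]; exact unitsField_mem_unitaryUnits _ _
  -- □₀ and its collar lie in the fine territory of □̃: the chart rows on the sides touching `Ω 0`, on `□_k`, on the stars of `Ω 0`
  have hcol : B8Ineq132.Collar (cube (F.P K).L (fun μ => ((iterBlockOf (K - n) x₀ μ).val : ℤ) - t) M' (ρ + M + L + S) (K - n) 0)
      (tlo (F.P K).L (tLo (fun μ => ((iterBlockOf (K - n) x₀ μ).val : ℤ) - t) (ρ + M + L + S)) (K - n))
      (thi (F.P K).L (tHi (fun μ => ((iterBlockOf (K - n) x₀ μ).val : ℤ) - t) M' (ρ + M + L + S)) (K - n)) := B8Eq131Cubes.collar_cube hL2 hρ1 (Nat.zero_le _)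
  have hcube : ∀ z ∈ cube (F.P K).L (fun μ => ((iterBlockOf (K - n) x₀ μ).val : ℤ) - t) M' (ρ + M + L + S) (K - n) 0, ∀ ν : Fin (F.P K).d,
      (tlo (F.P K).L (tLo (fun μ => ((iterBlockOf (K - n) x₀ μ).val : ℤ) - t) (ρ + M + L + S)) (K - n) ≤ z ∧
        z + e ν ≤ thi (F.P K).L (tHi (fun μ => ((iterBlockOf (K - n) x₀ μ).val : ℤ) - t) M' (ρ + M + L + S)) (K - n)) ∧
      (tlo (F.P K).L (tLo (fun μ => ((iterBlockOf (K - n) x₀ μ).val : ℤ) - t) (ρ + M + L + S)) (K - n) ≤ z - e ν ∧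
        z - e ν + e ν ≤ thi (F.P K).L (tHi (fun μ => ((iterBlockOf (K - n) x₀ μ).val : ℤ) - t) M' (ρ + M + L + S)) (K - n)) := by
    intro z hz ν
    have he : ∀ i, (0 : ℤ) ≤ e ν i ∧ e ν i ≤ 1 := fun i => by
      rw [B7Prop1Explicit.e_apply]; split_ifs <;> norm_num
    have h0 : InBox (tlo (F.P K).L (tLo (fun μ => ((iterBlockOf (K - n) x₀ μ).val : ℤ) - t) (ρ + M + L + S)) (K - n))
        (thi (F.P K).L (tHi (fun μ => ((iterBlockOf (K - n) x₀ μ).val : ℤ) - t) M' (ρ + M + L + S)) (K - n)) z := hcol z hz z fun i => ⟨by linarith, by linarith⟩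
    have h1 := hcol z hz (z + e ν) fun i => ⟨by have := (he i).1; simp only [Pi.add_apply]; linarith, by have := (he i).2; simp only [Pi.add_apply]; linarith⟩
    have h2 := hcol z hz (z - e ν) fun i => ⟨by have := (he i).2; simp only [Pi.sub_apply]; linarith, by have := (he i).1; simp only [Pi.sub_apply]; linarith⟩
    refine ⟨⟨fun i => (h0 i).1, fun i => (h1 i).2⟩, fun i => (h2 i).1, ?_⟩
    rw [sub_add_cancel]
    exact fun i => (h0 i).2
  have hΩ0 : cubeFam false (F.P K).L (fun μ => ((iterBlockOf (K - n) x₀ μ).val : ℤ) - t) M' (ρ + M + L + S) (K - n) 0 =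
      cube (F.P K).L (fun μ => ((iterBlockOf (K - n) x₀ μ).val : ℤ) - t) M' (ρ + M + L + S) (K - n) 0 := cubeFam_false_of_le _ _ _ _ (Nat.zero_le _)
  have hsides : ∀ (y : LSite (F.P K).d) (τ : Fin (F.P K).d),
      SideTouches (cubeFam false (F.P K).L (fun μ => ((iterBlockOf (K - n) x₀ μ).val : ℤ) - t) M' (ρ + M + L + S) (K - n) 0) y τ →
      pull (unitsField (toUField (GaugeField.gaugeAct gJ U))) 0 y τ = cfgExp (((F.L : ℝ)⁻¹) ^ (K - n)) A y τ ∧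
        ((F.L : ℝ)⁻¹) ^ (K - n) * ‖A y τ‖ ≤ 2 * s := by
    intro y τ hb
    rw [hΩ0] at hb
    obtain ⟨h1, h2⟩ := ends_of_sideTouches hcol hb
    exact ⟨(hterr y τ h1 h2).1, (hterr y τ h1 h2).2.1⟩
  have hchart₀ : ∀ b ∈ {b : LSite (F.P K).d × Fin (F.P K).d |
        SideTouches (cubeFam false (F.P K).L (fun μ => ((iterBlockOf (K - n) x₀ μ).val : ℤ) - t) M' (ρ + M + L + S) (K - n) 0) b.1 b.2},
      pull (unitsField (toUField (GaugeField.gaugeAct gJ U))) 0 b.1 b.2 = cfgExp (((F.L : ℝ)⁻¹) ^ (K - n)) A b.1 b.2 :=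
    fun b hb => (hsides b.1 b.2 hb).1
  have hchartTop : ∀ z ∈ cube (F.P K).L (fun μ => ((iterBlockOf (K - n) x₀ μ).val : ℤ) - t) M' (ρ + M + L + S) (K - n) (K - n), ∀ ν : Fin (F.P K).d,
      pull (unitsField (toUField (GaugeField.gaugeAct gJ U))) 0 z ν = cfgExp (((F.L : ℝ)⁻¹) ^ (K - n)) A z ν ∧
        ((F.L : ℝ)⁻¹) ^ (K - n) * ‖A z ν‖ ≤ 2 * s := by
    intro z hz ν
    have hz0 := B8Eq131Cubes.cube_anti (Nat.zero_le _) le_rfl hz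
    obtain ⟨⟨h1, h2⟩, -⟩ := hcube z hz0 ν
    exact ⟨(hterr z ν h1 h2).1, (hterr z ν h1 h2).2.1⟩
  have hArows : ∀ x ∈ cubeFam false (F.P K).L (fun μ => ((iterBlockOf (K - n) x₀ μ).val : ℤ) - t) M' (ρ + M + L + S) (K - n) 0, ∀ μ : Fin (F.P K).d,
      (pull (unitsField (toUField (GaugeField.gaugeAct gJ U))) 0 x μ = cfgExp (((F.L : ℝ)⁻¹) ^ (K - n)) A x μ ∧
          ((F.L : ℝ)⁻¹) ^ (K - n) * ‖A x μ‖ ≤ 2 * s) ∧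
        (pull (unitsField (toUField (GaugeField.gaugeAct gJ U))) 0 (x - e μ) μ = cfgExp (((F.L : ℝ)⁻¹) ^ (K - n)) A (x - e μ) μ ∧
          ((F.L : ℝ)⁻¹) ^ (K - n) * ‖A (x - e μ) μ‖ ≤ 2 * s) := by
    intro x hx μ
    rw [hΩ0] at hx
    obtain ⟨⟨h1, h2⟩, h3, h4⟩ := hcube x hx μ
    exact ⟨⟨(hterr x μ h1 h2).1, (hterr x μ h1 h2).2.1⟩, (hterr (x - e μ) μ h3 h4).1, (hterr (x - e μ) μ h3 h4).2.1⟩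
  have hfine : ∀ (x : LSite (F.P K).d) (ν : Fin (F.P K).d),
      tlo (F.P K).L (tLo (fun μ => ((iterBlockOf (K - n) x₀ μ).val : ℤ) - t) (ρ + M + L + S)) (K - n) ≤ x →
      x + e ν ≤ thi (F.P K).L (tHi (fun μ => ((iterBlockOf (K - n) x₀ μ).val : ℤ) - t) M' (ρ + M + L + S)) (K - n) →
      ‖((pull (unitsField (toUField (GaugeField.gaugeAct gJ U))) 0 x ν : (Matrix (Fin 2) (Fin 2) ℂ)ˣ) : Matrix (Fin 2) (Fin 2) ℂ) - 1‖ < s :=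
    fun x ν h1 h2 => (hterr x ν h1 h2).2.2
  -- F3's effective-gauge tower of the charted iterate at the composite gauge (`u₁ := 1`)
  obtain ⟨κf, hκfs, hκf0, -⟩ := exists_effGaugeFun (P := F.P K) (gaugeActT (fun s => ((1 : LSite (F.P K).d → (Matrix (Fin 2) (Fin 2) ℂ)ˣ) (lift (F.P K) x₀ + rel x₀ s))⁻¹ * Unitary.toUnits (suIncl (gJ s)) : GaugeTransf (F.P K) 0 (Matrix (Fin 2) (Fin 2) ℂ)ˣ) (unitsField (toUField U)))
  -- the torus package at this gauge and tower
  obtain ⟨th, hτ, hth, hthk, hthlo, haxT, hthτ, ha₁', hb₁', hθ, hh₀', h103, h106, hTop121, hTop125, hTopReal, hTopTrace⟩ := hTorus gJ hfine κf hκfs hκf0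
  -- THE BASE TOP STEP at the member (✓p657394, `k := K − n`, `hk1 := hKn`)
  obtain ⟨lam, hsa, hsupp, hτ0, h108, hmult, hlo, htopId, hA0⟩ := siteTopRows_of_sockets_base (P := F.P K) (trCLM (Fin 2)) (trCLM_mul_comm (n := Fin 2))
    hd2 hL2 hη x₀ hρL hKn hkP ha hroomW rfl rfl hAsa hAτ hs0 hArows hα₄ hcAw hcDAw hcA13 hB₀'H hB₂' hBG hBR SLetτ hCb hCl hCbρ hClB
    (gaugeActT (fun s => ((1 : LSite (F.P K).d → (Matrix (Fin 2) (Fin 2) ℂ)ˣ) (lift (F.P K) x₀ + rel x₀ s))⁻¹ * Unitary.toUnits (suIncl (gJ s)) : GaugeTransf (F.P K) 0 (Matrix (Fin 2) (Fin 2) ℂ)ˣ) (unitsField (toUField U))) κf th hτ hth hthk hthlo haxT ha₁' hb₁' hθ hh₀' h103 h106 hTop121 hTop125 hTopReal hthτ hTopTrace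
  have htr : ∀ x, (lam x).trace = 0 := fun x => by rw [← trCLM_apply]; exact hτ0 x
  exact ⟨gJ, A, κf, lam, hInAk, hInAx, htree, htower, hsides, hchartTop, hAsa, hκfs, hκf0, hsa, hsupp, htr, h108, hmult, hlo, htopId, hA0⟩


end Summit.QuantumFields.YangMills.Theorems.HalvingHSiteBaseDataOfSocketsTR

end
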